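import Mathlib
import Summits.MatrixMultiplication.MatrixMultiplication.Theorems.FidelityWitnessesFidelityThesisSepMajorantSingleProduct

/-!
# Line `Sketch` (separable-majorant) for crux `FidelityWitnesses.FidelityThesis` (stmt-MatrixMultiplication-4956) —
stub `stub_pairCoordinates`: coordinates of the product-span basis in the orthonormal PAIR FAMILY

Slots `b, c : Fin n × Fin n`, pairing `⟨f, g⟩ = Σ_{b,c} conj f · g` on `ℂ^{n×n} ⊗ ℂ^{n×n}`.
Data: `r` products `u_l ⊗ v_l`; an orthonormal basis `e_s = Σ_l co'_{sl} · u_l ⊗ v_l` (`s < d`) of their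
span `E`; orthonormal families `a_i` (`i < k`) and `b'_j` (`j < k'`) carrying the factors,
`u_l = Σ_i α_{li} a_i`, `v_l = Σ_j β_{lj} b'_j`.

Claim.  With `γ_s(i,j) := Σ_l co'_{sl} α_{li} β_{lj}` one has `e_s = Σ_{(i,j)} γ_s(i,j) · a_i ⊗ b'_j`
(expand both factors and regroup over the pair index `q = (i,j) : Fin k × Fin k'`), and the coordinate
vectors are orthonormal: `Σ_q conj γ_s(q) γ_t(q) = ⟨e_s, e_t⟩ = δ_{st}`.  The second part is the polarised
Parseval identity in the pair family `f_q := a_{q.1} ⊗ b'_{q.2}`, which is itself orthonormal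
(`⟨f_q, f_{q'}⟩ = ⟨a_i, a_{i'}⟩ ⟨b'_j, b'_{j'}⟩ = δ_{qq'}`): `⟨f_q, e_t⟩ = γ_t(q)` (coefficient extraction),
hence `⟨e_s, e_t⟩ = Σ_q conj γ_s(q) ⟨f_q, e_t⟩ = Σ_q conj γ_s(q) γ_t(q)`.
Downstream (`fidelity_le_rpow_threeHalves`) the expansion feeds `stub_capBound` and the orthonormality of
`γ` feeds `stub_gramFrobenius`.  Supports item `stmt-MatrixMultiplication-4956`; no definitions; imports
toolkit I only.
-/

namespace Summit.MatrixMultiplication.MatrixMultiplication.Theorems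

open scoped BigOperators ComplexConjugate
open Literature.Computability.AlgebraicComplexity

/-- Gram matrix of the pair family `a_i ⊗ b'_j` of two orthonormal families, conjugate distributed over
the two factors: `Σ_{b,c} conj a_i(b) · conj b'_j(c) · a_{i'}(b) b'_{j'}(c) = δ_{(i,j),(i',j')}`. [folklore] -/
theorem sepMajorantPC_pairFamily_gram {n k k' : ℕ} (a : Fin k → Fin n × Fin n → ℂ)
    (b' : Fin k' → Fin n × Fin n → ℂ)
    (ha : ∀ i i' : Fin k, (∑ b, conj (a i b) * a i' b) = if i = i' then 1 else 0)
    (hb : ∀ j j' : Fin k', (∑ c, conj (b' j c) * b' j' c) = if j = j' then 1 else 0)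
    (q q' : Fin k × Fin k') :
    ∑ b, ∑ c, conj (a q.1 b) * conj (b' q.2 c) * (a q'.1 b * b' q'.2 c) =
      if q = q' then 1 else 0 := by
  -- adapted from `sepMajorantTM_productFrame_orthonormal`
  --   (Theorems/FidelityWitnessesFidelityThesisStubTrivialMajorant)
  calc ∑ b, ∑ c, conj (a q.1 b) * conj (b' q.2 c) * (a q'.1 b * b' q'.2 c)
      = ∑ b, ∑ c, conj (a q.1 b) * a q'.1 b * (conj (b' q.2 c) * b' q'.2 c) :=
        Finset.sum_congr rfl fun b _ => Finset.sum_congr rfl fun c _ => by ring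
    _ = (∑ b, conj (a q.1 b) * a q'.1 b) * ∑ c, conj (b' q.2 c) * b' q'.2 c := by
        rw [Fintype.sum_mul_sum]
    _ = if q = q' then 1 else 0 := by
        rw [ha, hb]
        obtain ⟨i, j⟩ := q
        obtain ⟨i', j'⟩ := q'
        by_cases hi : i = i' <;> by_cases hj : j = j' <;> simp [hi, hj]

/-- Coefficient extraction in the pair family `a_i ⊗ b'_j` of two orthonormal families: if
`G = Σ_q δ_q · a_{q.1} ⊗ b'_{q.2}` then `Σ_{b,c} conj a_i(b) · conj b'_j(c) · G(b,c) = δ_{(i,j)}`. [folklore] -/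
theorem sepMajorantPC_pairFamily_coefficient {n k k' : ℕ} (a : Fin k → Fin n × Fin n → ℂ)
    (b' : Fin k' → Fin n × Fin n → ℂ)
    (ha : ∀ i i' : Fin k, (∑ b, conj (a i b) * a i' b) = if i = i' then 1 else 0)
    (hb : ∀ j j' : Fin k', (∑ c, conj (b' j c) * b' j' c) = if j = j' then 1 else 0)
    (δ : Fin k × Fin k' → ℂ) (G : (Fin n × Fin n) → (Fin n × Fin n) → ℂ)
    (hG : ∀ b c, G b c = ∑ q, δ q * (a q.1 b * b' q.2 c)) (q : Fin k × Fin k') :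
    ∑ b, ∑ c, conj (a q.1 b) * conj (b' q.2 c) * G b c = δ q := by
  -- adapted from `sepMajorantTM_frame_coefficient` (Theorems/FidelityWitnessesFidelityThesisStubTrivialMajorant)
  calc ∑ b, ∑ c, conj (a q.1 b) * conj (b' q.2 c) * G b c
      = ∑ b, ∑ c, ∑ q', δ q' * (conj (a q.1 b) * conj (b' q.2 c) * (a q'.1 b * b' q'.2 c)) := by
        refine Finset.sum_congr rfl fun b _ => Finset.sum_congr rfl fun c _ => ?_
        rw [hG b c, Finset.mul_sum]
        exact Finset.sum_congr rfl fun q' _ => by ring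
    _ = ∑ b, ∑ q', ∑ c, δ q' * (conj (a q.1 b) * conj (b' q.2 c) * (a q'.1 b * b' q'.2 c)) :=
        Finset.sum_congr rfl fun b _ => Finset.sum_comm
    _ = ∑ q', ∑ b, ∑ c, δ q' * (conj (a q.1 b) * conj (b' q.2 c) * (a q'.1 b * b' q'.2 c)) :=
        Finset.sum_comm
    _ = ∑ q', δ q' * ∑ b, ∑ c, conj (a q.1 b) * conj (b' q.2 c) * (a q'.1 b * b' q'.2 c) := by
        refine Finset.sum_congr rfl fun q' _ => ?_
        rw [Finset.mul_sum]
        exact Finset.sum_congr rfl fun b _ => by rw [Finset.mul_sum]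
    _ = ∑ q', δ q' * (if q = q' then 1 else 0) :=
        Finset.sum_congr rfl fun q' _ => by rw [sepMajorantPC_pairFamily_gram a b' ha hb q q']
    _ = δ q := by simp

/-- Polarised Parseval identity in the pair family `a_i ⊗ b'_j` of two orthonormal families: if
`F = Σ_q γ_q · a_{q.1} ⊗ b'_{q.2}` and `G = Σ_q δ_q · a_{q.1} ⊗ b'_{q.2}` then
`⟨F, G⟩ = Σ_{b,c} conj F · G = Σ_q conj γ_q · δ_q`. [folklore] -/
theorem sepMajorantPC_pairFamily_polarization {n k k' : ℕ} (a : Fin k → Fin n × Fin n → ℂ)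
    (b' : Fin k' → Fin n × Fin n → ℂ)
    (ha : ∀ i i' : Fin k, (∑ b, conj (a i b) * a i' b) = if i = i' then 1 else 0)
    (hb : ∀ j j' : Fin k', (∑ c, conj (b' j c) * b' j' c) = if j = j' then 1 else 0)
    (γ δ : Fin k × Fin k' → ℂ) (F G : (Fin n × Fin n) → (Fin n × Fin n) → ℂ)
    (hF : ∀ b c, F b c = ∑ q, γ q * (a q.1 b * b' q.2 c))
    (hG : ∀ b c, G b c = ∑ q, δ q * (a q.1 b * b' q.2 c)) :
    ∑ b, ∑ c, conj (F b c) * G b c = ∑ q, conj (γ q) * δ q := by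
  -- pattern of `sepMajorantTM_parseval` (Theorems/FidelityWitnessesFidelityThesisStubTrivialMajorant), polarised
  have hFc : ∀ b c, conj (F b c) = ∑ q, conj (γ q) * (conj (a q.1 b) * conj (b' q.2 c)) := by
    intro b c
    rw [hF b c, map_sum]
    exact Finset.sum_congr rfl fun q _ => by rw [map_mul, map_mul]
  calc ∑ b, ∑ c, conj (F b c) * G b c
      = ∑ b, ∑ c, ∑ q, conj (γ q) * (conj (a q.1 b) * conj (b' q.2 c) * G b c) := by
        refine Finset.sum_congr rfl fun b _ => Finset.sum_congr rfl fun c _ => ?_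
        rw [hFc b c, Finset.sum_mul]
        exact Finset.sum_congr rfl fun q _ => by ring
    _ = ∑ b, ∑ q, ∑ c, conj (γ q) * (conj (a q.1 b) * conj (b' q.2 c) * G b c) :=
        Finset.sum_congr rfl fun b _ => Finset.sum_comm
    _ = ∑ q, ∑ b, ∑ c, conj (γ q) * (conj (a q.1 b) * conj (b' q.2 c) * G b c) := Finset.sum_comm
    _ = ∑ q, conj (γ q) * ∑ b, ∑ c, conj (a q.1 b) * conj (b' q.2 c) * G b c := by
        refine Finset.sum_congr rfl fun q _ => ?_
        rw [Finset.mul_sum]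
        exact Finset.sum_congr rfl fun b _ => by rw [Finset.mul_sum]
    _ = ∑ q, conj (γ q) * δ q :=
        Finset.sum_congr rfl fun q _ => by
          rw [sepMajorantPC_pairFamily_coefficient a b' ha hb δ G hG q]

/-- **Coordinates of the product-span basis in the pair family.**  If `e_s = Σ_l co'_{sl} · u_l ⊗ v_l`
(`s < d`) is orthonormal, `u_l = Σ_i α_{li} a_i` and `v_l = Σ_j β_{lj} b'_j` with `a_i`, `b'_j` orthonormal
families, then `γ_s(i,j) := Σ_l co'_{sl} α_{li} β_{lj}` satisfies `e_s = Σ_{(i,j)} γ_s(i,j) · a_i ⊗ b'_j`, and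
the coordinate vectors `γ_s` are orthonormal: `Σ_q conj γ_s(q) γ_t(q) = ⟨e_s, e_t⟩ = δ_{st}` (polarised
Parseval in the orthonormal pair family `a_i ⊗ b'_j`). [folklore] -/
theorem stub_pairCoordinates {n r d k k' : ℕ} (u v : Fin r → Fin n × Fin n → ℂ)
    (e : Fin d → Fin n × Fin n → Fin n × Fin n → ℂ)
    (he : ∀ s t : Fin d, (∑ b, ∑ c, conj (e s b c) * e t b c) = if s = t then 1 else 0)
    (co' : Fin d → Fin r → ℂ)
    (hco' : ∀ (s : Fin d) (b c : Fin n × Fin n), e s b c = ∑ l, co' s l * (u l b * v l c))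
    (a : Fin k → Fin n × Fin n → ℂ) (b' : Fin k' → Fin n × Fin n → ℂ)
    (ha : ∀ i i' : Fin k, (∑ b, conj (a i b) * a i' b) = if i = i' then 1 else 0)
    (hb : ∀ j j' : Fin k', (∑ c, conj (b' j c) * b' j' c) = if j = j' then 1 else 0)
    (α : Fin r → Fin k → ℂ) (β : Fin r → Fin k' → ℂ)
    (hu : ∀ (l : Fin r) (b : Fin n × Fin n), u l b = ∑ i, α l i * a i b)
    (hv : ∀ (l : Fin r) (c : Fin n × Fin n), v l c = ∑ j, β l j * b' j c) :
    ∃ γ : Fin d → Fin k × Fin k' → ℂ,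
      (∀ (s : Fin d) (b c : Fin n × Fin n), e s b c = ∑ q, γ s q * (a q.1 b * b' q.2 c)) ∧
      (∀ s t : Fin d, (∑ q, conj (γ s q) * γ t q) = if s = t then 1 else 0) := by
  -- (1) expansion of each `e_s` in the pair family, regrouped over `q = (i, j)`
  have hexp : ∀ (s : Fin d) (b c : Fin n × Fin n),
      e s b c = ∑ q : Fin k × Fin k', (∑ l, co' s l * α l q.1 * β l q.2) * (a q.1 b * b' q.2 c) := by
    intro s b c
    rw [hco' s b c]
    -- adapted from `sepMajorantTM_span_coordinates` (Theorems/FidelityWitnessesFidelityThesisStubTrivialMajorant)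
    calc ∑ l, co' s l * (u l b * v l c)
        = ∑ l, ∑ i, ∑ j, co' s l * α l i * β l j * (a i b * b' j c) := by
          refine Finset.sum_congr rfl fun l _ => ?_
          rw [hu l b, hv l c, Fintype.sum_mul_sum, Finset.mul_sum]
          refine Finset.sum_congr rfl fun i _ => ?_
          rw [Finset.mul_sum]
          exact Finset.sum_congr rfl fun j _ => by ring
      _ = ∑ l, ∑ q : Fin k × Fin k', co' s l * α l q.1 * β l q.2 * (a q.1 b * b' q.2 c) :=
          Finset.sum_congr rfl fun l _ =>
            (Fintype.sum_prod_type' fun i j => co' s l * α l i * β l j * (a i b * b' j c)).symm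
      _ = ∑ q : Fin k × Fin k', ∑ l, co' s l * α l q.1 * β l q.2 * (a q.1 b * b' q.2 c) :=
          Finset.sum_comm
      _ = ∑ q : Fin k × Fin k', (∑ l, co' s l * α l q.1 * β l q.2) * (a q.1 b * b' q.2 c) :=
          Finset.sum_congr rfl fun q _ => by rw [Finset.sum_mul]
  refine ⟨fun s q => ∑ l, co' s l * α l q.1 * β l q.2, hexp, fun s t => ?_⟩
  -- (2) orthonormality transfer: `Σ_q conj γ_s(q) γ_t(q) = ⟨e_s, e_t⟩ = δ_{st}`
  rw [← he s t]
  exact (sepMajorantPC_pairFamily_polarization a b' ha hb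
    (fun q => ∑ l, co' s l * α l q.1 * β l q.2) (fun q => ∑ l, co' t l * α l q.1 * β l q.2)
    (e s) (e t) (hexp s) (hexp t)).symm

end Summit.MatrixMultiplication.MatrixMultiplication.Theorems
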